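import Mathlib
import Literature.NumberTheory.LFunctions.Zhang2022.SkeletonPartThree
import Literature.NumberTheory.LFunctions.Zhang2022.TypedAppendixB
import Literature.NumberTheory.LFunctions.Zhang2022.SkeletonAlpha1
import Literature.NumberTheory.LFunctions.Zhang2022.AppendixBLemma151Circles
import Literature.NumberTheory.LFunctions.Zhang2022.AppendixBLemma151Residues
import Literature.NumberTheory.LFunctions.Zhang2022.AppendixBLemma151ResBetaValue
import Literature.NumberTheory.LFunctions.Zhang2022.AppendixBLemma151Mu3Circles
import Literature.NumberTheory.LFunctions.Zhang2022.AppendixBLemma151Mu1Circles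

/-!
# Zhang (2022) Appendix B, proof of Lemma 15.1, `μ = 1`: the VALUE of the residue at `s = β₆` of
# `ζ(1+s)/ζ(1+s−β_j)·(P₁/l₁)ˢ/((log P₁)(s−β₆)²)` — "`= (1 − 2j/3 + j/(1.134πi))e^{0.756πi} + O(α₁)`"

Topic `Literature/NumberTheory/LFunctions/Zhang2022` (Landau–Siegel audit tree; verdict-neutral).
Y. Zhang, *Discrete mean estimates and the Landau–Siegel zero*, arXiv:2211.02515v1 (2022)
[Zhang2022LandauSiegel] — **an unrefereed manuscript under adjudication; nothing in this file
asserts any claim of the manuscript beyond the displayed evaluation it PROVES.** ZHANG-L discharge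
lane (WP15, App. B block B4 under the leaf `Typed.Section15C.Eq15_22`, Lemma 15.1 χ-reading; seat
zl-w09-p5), DAG node `Z22:§B.u012` [Z22 p.107, tex L5311]: "The same argument also gives
`Σ_l ϰ₁(l₁l)ϱ_j(l)/l = (1 − 2j/3 + j/(1.134πi)) exp{0.756πi} − j/(1.134πi) + O(α₁)`" — here the
`β₆`-residue part of that argument, i.e. the hypothesis `h11` of `Skeleton.stepB_u012R_of`
(`AppendixBLemma151Mu1Circles`), in the reading of record `α₁ = α log T`.

What is PROVED (`circleIntegral_intB1_beta6_sub_main_le`): for `D` large, `j ∈ {1,2,3}`, `1 ≤ l₁ < T`,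
`‖(2πi)⁻¹∮_{|s−β₆|=α} ζ(1+s)/ζ(1+s−β_j)·(P₁/l₁)ˢ/((log P₁)(s−β₆)²) ds − (1 − 2j/3 + j/(1.134πi))e^{0.756πi}‖
≤ C(c′)·α₁`. This is the `(P₁, β₆)` TWIN of zl-w15-p3's `μ = 2` evaluation
`AppendixBLemma151ResBetaValue.stepB_u011bR_holds` (at `(P₂, β₇)`), composed with the Cauchy-formula
identification of `AppendixBLemma151ResBeta.stepB_u011a_holds`: by `circleIntegrals_intB_beta6` (the
generic-base circle layer of `AppendixBLemma151Mu1Circles`) the circle integral is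
`−G(β₆)/β₆² + G′(β₆)/β₆`, `G(s) = ζ₁(1+s)(s−β_j)ζ₁(1+s−β_j)⁻¹(P₁/l₁)ˢ/log P₁ = s·Z(s)·xˢ/L` near `β₆`
(`Z = ζ(1+·)/ζ(1+·−β_j)`, `x = P₁/l₁`, `L = log P₁ = 0.504𝓛⁹` EXACTLY — no `T`-term, unlike `log P₂`),
whence `= x^{β₆}(Z(β₆)·log x/L + Z′(β₆)/L) = x^{β₆}[u(1 − β_j/β₆)·log x/L + u′(β₆−β_j)/(β₆L) + u·β_j/(β₆²L)]`
with `u = ζ₁(1+β₆)/ζ₁(1+β₆−β_j) = 1 + O(α)`, `u′ = O(1)` (`zeta1_near_one`, `zetaRatio_local_at`); and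
`x^{β₆} = e^{0.756πi} + O(α𝓛^{1.1})` (`β₆ = 3iα/2`, `(3/2)·0.504·α𝓛⁹ = 0.756π`, `log l₁ < 𝓛^{1.1}`),
`β_j/β₆ = (2j/3)(1 + O(c′α𝓛))` ((2.13)), `log x/L = 1 + O(𝓛^{1.1}/𝓛⁹)`,
`β_j/(β₆²L) = j/(1.134πi) + O(α₁)` (`resZero1_sub_main_le`), `(β₆−β_j)/(β₆L) = O(𝓛⁻⁹)`.
Every constant is explicit; hypothesis (A) and the character are not used.

With `Skeleton.stepB_u012R_of` (assembly), `Skeleton.vkSum_vk1_eq_vline` (the `μ = 1` Perron identity,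
`AppendixBPerronGeneric`, zl-libA-p6) this leaves ONLY the `μ = 1` line-to-circle contour bound open for
`Typed.AppendixB.StepB_u012R` (to be instantiated from the lane's generic App. B contour engine).

WHAT THIS IS NOT: the contour shift, the cases `μ = 2, 3`, (B.3), Lemma 15.1, or any claim about
Theorems 1–2 / Landau–Siegel zeros.

## References

* Y. Zhang, arXiv:2211.02515v1 (2022), App. B p. 107 (proof of Lemma 15.1, `μ = 1`); §2 (2.10),
  (2.13), (2.21), (2.22); Lemma 15.1 p. 80 (`e′_{1j}`). [cite: Zhang2022LandauSiegel, App. B p.107]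
-/

noncomputable section

open Complex Real Metric Set Filter Topology

namespace Literature.NumberTheory.LFunctions.Zhang2022.Skeleton

open Typed.AppendixB (zetaRatio kerB)

section Mu1Value

variable (c' : ℝ)

/-- `L₀ ≤ log D` once `D ≥ ⌈exp L₀⌉₊`. [folklore] -/
private theorem le_ell_of_ceil_exp_le₆ {L₀ : ℝ} {D : ℕ} (hD : ⌈Real.exp L₀⌉₊ ≤ D) : L₀ ≤ ell D := by
  have h : Real.exp L₀ ≤ D := le_trans (Nat.le_ceil _) (by exact_mod_cast hD)
  exact (Real.le_log_iff_exp_le (lt_of_lt_of_le (Real.exp_pos _) h)).mpr h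

/-- The bookkeeping inequality behind the evaluation (the `β₆`-variant of the one in
`AppendixBLemma151ResBetaValue`, with the sizes `‖q‖ ≤ 3`, `‖m‖ ≤ 2` that the pole `β₆ = 3iα/2` allows):
if `E ≈ e₀`, `u ≈ 1`, `r ≈ 1`, `q ≈ q₀`, `m ≈ m₀`, `w ≈ 0` to within `ε`, then
`E(u(1−q)r + u′w + um) − e₀((1−q₀) + m₀) = O(ε)`. [folklore] -/
private theorem main_term_bookkeeping₆ (E e₀ u u' r q q₀ m m₀ w : ℂ) {ε M : ℝ} (hε : 0 ≤ ε)
    (hM : 0 ≤ M) (hE : ‖E‖ ≤ 1) (he : ‖e₀‖ ≤ 1) (hu : ‖u‖ ≤ 7) (hq : ‖q‖ ≤ 3) (hr : ‖r‖ ≤ 1)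
    (hm : ‖m‖ ≤ 2) (hu' : ‖u'‖ ≤ M) (h1 : ‖E - e₀‖ ≤ ε) (h2 : ‖u - 1‖ ≤ ε) (h3 : ‖r - 1‖ ≤ ε)
    (h4 : ‖q - q₀‖ ≤ ε) (h5 : ‖m - m₀‖ ≤ ε) (h6 : ‖w‖ ≤ ε) :
    ‖E * (u * (1 - q) * r + u' * w + u * m) - e₀ * ((1 - q₀) + m₀)‖ ≤ (54 + 3 * M) * ε := by
  have hid : E * (u * (1 - q) * r + u' * w + u * m) - e₀ * ((1 - q₀) + m₀) =
      (E - e₀) * (u * (1 - q) * r + u * m) + (E - e₀) * (u' * w) + e₀ * ((u - 1) * (1 - q) * r) +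
        e₀ * ((1 - q) * (r - 1)) + e₀ * (q₀ - q) + e₀ * (u' * w) + e₀ * ((u - 1) * m) +
        e₀ * (m - m₀) := by ring
  have h1q : ‖1 - q‖ ≤ 4 := by
    calc ‖1 - q‖ ≤ ‖(1 : ℂ)‖ + ‖q‖ := norm_sub_le _ _
      _ ≤ 1 + 3 := by rw [norm_one]; linarith
      _ = 4 := by norm_num
  have hEe : ‖E - e₀‖ ≤ 2 := by
    calc ‖E - e₀‖ ≤ ‖E‖ + ‖e₀‖ := norm_sub_le _ _
      _ ≤ 2 := by linarith
  have hq0 : ‖q₀ - q‖ ≤ ε := by rw [norm_sub_rev]; exact h4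
  -- the eight pieces
  have hA1 : ‖(E - e₀) * (u * (1 - q) * r + u * m)‖ ≤ ε * 42 := by
    rw [norm_mul]
    have hin : ‖u * (1 - q) * r + u * m‖ ≤ 42 := by
      calc ‖u * (1 - q) * r + u * m‖ ≤ ‖u * (1 - q) * r‖ + ‖u * m‖ := norm_add_le _ _
        _ = ‖u‖ * ‖1 - q‖ * ‖r‖ + ‖u‖ * ‖m‖ := by rw [norm_mul, norm_mul, norm_mul]
        _ ≤ 7 * 4 * 1 + 7 * 2 := by gcongr
        _ = 42 := by norm_num
    exact mul_le_mul h1 hin (norm_nonneg _) hε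
  have hA2 : ‖(E - e₀) * (u' * w)‖ ≤ 2 * (M * ε) := by
    rw [norm_mul, norm_mul]
    exact mul_le_mul hEe (mul_le_mul hu' h6 (norm_nonneg _) hM) (by positivity) (by norm_num)
  have hB1 : ‖e₀ * ((u - 1) * (1 - q) * r)‖ ≤ 1 * (ε * 4 * 1) := by
    rw [norm_mul, norm_mul, norm_mul]
    refine mul_le_mul he ?_ (by positivity) (by norm_num)
    exact mul_le_mul (mul_le_mul h2 h1q (norm_nonneg _) hε) hr (norm_nonneg _) (by positivity)
  have hB2 : ‖e₀ * ((1 - q) * (r - 1))‖ ≤ 1 * (4 * ε) := by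
    rw [norm_mul, norm_mul]
    exact mul_le_mul he (mul_le_mul h1q h3 (norm_nonneg _) (by norm_num)) (by positivity)
      (by norm_num)
  have hB3 : ‖e₀ * (q₀ - q)‖ ≤ 1 * ε := by
    rw [norm_mul]; exact mul_le_mul he hq0 (norm_nonneg _) (by norm_num)
  have hB4 : ‖e₀ * (u' * w)‖ ≤ 1 * (M * ε) := by
    rw [norm_mul, norm_mul]
    exact mul_le_mul he (mul_le_mul hu' h6 (norm_nonneg _) hM) (by positivity) (by norm_num)
  have hB5 : ‖e₀ * ((u - 1) * m)‖ ≤ 1 * (ε * 2) := by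
    rw [norm_mul, norm_mul]
    exact mul_le_mul he (mul_le_mul h2 hm (norm_nonneg _) hε) (by positivity) (by norm_num)
  have hB6 : ‖e₀ * (m - m₀)‖ ≤ 1 * ε := by
    rw [norm_mul]; exact mul_le_mul he h5 (norm_nonneg _) (by norm_num)
  rw [hid]
  have hsum := norm_add_le_of_le (norm_add_le_of_le (norm_add_le_of_le (norm_add_le_of_le
    (norm_add_le_of_le (norm_add_le_of_le (norm_add_le_of_le hA1 hA2) hB1) hB2) hB3) hB4) hB5) hB6
  refine hsum.trans ?_
  nlinarith

/-- `|e^{iθ₁} − e^{iθ₂}| ≤ |θ₁ − θ₂|` for real `θ₁, θ₂`. [folklore] -/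
private theorem norm_cexp_I_sub_cexp_I_le₆ (θ₁ θ₂ : ℝ) :
    ‖cexp ((θ₁ : ℂ) * I) - cexp ((θ₂ : ℂ) * I)‖ ≤ |θ₁ - θ₂| := by
  have hfac : cexp ((θ₁ : ℂ) * I) - cexp ((θ₂ : ℂ) * I) =
      cexp ((θ₂ : ℂ) * I) * (cexp (I * ((θ₁ - θ₂ : ℝ) : ℂ)) - 1) := by
    rw [mul_sub, mul_one, ← Complex.exp_add]
    congr 1
    push_cast
    ring_nf
  rw [hfac, norm_mul, Complex.norm_exp_ofReal_mul_I, one_mul]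
  have := @Real.norm_exp_I_mul_ofReal_sub_one_le (θ₁ - θ₂)
  rwa [Real.norm_eq_abs] at this

/-- The pure algebra of the evaluation (as in `AppendixBLemma151ResBetaValue`): with
`Z(β) = u(β−b)/β`, `Z′(β) = ((u′(β−b) + u)β − u(β−b))/β²`, the Cauchy-formula expression
`Z(β)·r·E + L⁻¹·E·Z′(β)` regroups as `E(u(1 − b/β)r + u′(β−b)/(βL) + u·b/(β²L))`. [folklore] -/
private theorem resBeta_algebra₆ (E r u u' β b Lc : ℂ) (hβ : β ≠ 0) (hL : Lc ≠ 0) :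
    u * (β - b) / β * r * E +
        1 / Lc * E * (((u' * (β - b) + u * 1) * β - u * (β - b) * 1) / β ^ 2) =
      E * (u * (1 - b / β) * r + u' * ((β - b) / (β * Lc)) + u * (b / (β ^ 2 * Lc))) := by
  field_simp
  ring

/-- The residue at the double pole in Cauchy-formula form: with `G(β) = β·Z·E/L` and
`G′(β) = ((Z + β·Z′)E + β·Z·(E·ℓx))/L` one has `−G(β)/β² + G′(β)/β = Z·(ℓx/L)·E + L⁻¹·E·Z′`. [folklore] -/
private theorem circle_residue_algebra₆ (Z Z' E lx β Lc : ℂ) (hβ : β ≠ 0) (hL : Lc ≠ 0) :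
    -(β * Z * E / Lc / β ^ 2) + ((1 * Z + β * Z') * E + β * Z * (E * lx)) / Lc / β =
      Z * (lx / Lc) * E + 1 / Lc * E * Z' := by
  field_simp
  ring

/-- `x^{iθ}` for real `x > 0`: `(x : ℂ)^{(c : ℝ)·i} = e^{i·c·log x}`. [folklore] -/
private theorem ofReal_cpow_mul_I₆ {x : ℝ} (hx : 0 < x) (c : ℝ) :
    ((x : ℝ) : ℂ) ^ (((c : ℝ) : ℂ) * I) = cexp (((c * Real.log x : ℝ) : ℂ) * I) := by
  have hx0 : ((x : ℝ) : ℂ) ≠ 0 := by exact_mod_cast hx.ne'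
  rw [Complex.cpow_def_of_ne_zero hx0, ← Complex.ofReal_log hx.le]
  congr 1
  push_cast
  ring

set_option maxHeartbeats 400000 in
/-- **The value of the `β₆`-circle of the `μ = 1` integrand** (Z22:§B.u012 via §B.u011, the
`(P₁, β₆)` twin of `StepB_u011bR`, reading of record `α₁ = α log T`): for `D` large, every
`j ∈ {1,2,3}` and `1 ≤ l₁ < T`,
`‖(2πi)⁻¹∮_{|s−β₆|=α} ζ(1+s)/ζ(1+s−β_j)·(P₁/l₁)ˢ/((log P₁)(s−β₆)²) ds − (1 − 2j/3 + j/(1.134πi))e^{0.756πi}‖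
≤ C·α₁` with an explicit `C = C(c′)` — the hypothesis `h11` of `Skeleton.stepB_u012R_of`.
See the module docstring for the computation. [cite: Zhang2022LandauSiegel, App. B p.107] -/
theorem circleIntegral_intB1_beta6_sub_main_le : ∃ C : ℝ, ForAllLarge fun D _ _ =>
    ∀ j ∈ ({1, 2, 3} : Finset ℕ), ∀ l₁ : ℕ, 1 ≤ l₁ → l₁ ∈ nset (frakq D) → (l₁ : ℝ) < bigT D →
      ‖(2 * π * I)⁻¹ * (∮ s in C(beta6 D, alpha D), zetaRatio c' D j s * kerB (P1 D) (beta6 D) l₁ s) -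
          (1 - 2 * (j : ℂ) / 3 + (j : ℂ) / (1.134 * π * I)) * cexp (0.756 * π * I)‖ ≤
        C * alpha1 D := by
  obtain ⟨δ, hδ, K, hK, hζ⟩ := zeta1_near_one
  obtain ⟨Cz, D₁, hCz⟩ := resZero1_sub_main_le c'
  obtain ⟨D₂, hcirc⟩ := circleIntegrals_intB_beta6 c' P1 one_lt_P1_mu1
  -- constants
  set C₁ : ℝ := max (max (10 * K) 28) (max (10 * |c'|) (max Cz 0)) with hC₁
  have hC₁K : 10 * K ≤ C₁ := le_trans (le_max_left _ _) (le_max_left _ _)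
  have hC₁28 : (28 : ℝ) ≤ C₁ := le_trans (le_max_right _ _) (le_max_left _ _)
  have hC₁c : 10 * |c'| ≤ C₁ := le_trans (le_max_left _ _) (le_max_right _ _)
  have hC₁z : Cz ≤ C₁ := le_trans (le_trans (le_max_left _ _) (le_max_right _ _)) (le_max_right _ _)
  have hC₁0 : 0 ≤ C₁ := le_trans (by norm_num) hC₁28
  have hK10 : 0 ≤ 10 * K := by positivity
  refine ⟨(54 + 3 * (3 * K)) * C₁,
    max D₁ (max D₂ (max 8 ⌈Real.exp (max (max 2 (60 * |c'| * π)) (max (10 * π / δ) (8 * (10 * K) * π)))⌉₊)),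
    fun D _ χ hD hq hp j hj l₁ hl₁ _ hT => ?_⟩
  have hD₁ : D₁ ≤ D := le_trans (le_max_left _ _) hD
  have hD₂ : D₂ ≤ D := le_trans (le_max_left _ _) (le_trans (le_max_right _ _) hD)
  obtain ⟨hℓ2, hc, hδα, hKα, hα0, hαπ, -⟩ := large_package c' hδ hK10
    (le_ell_of_ceil_exp_le₆ (le_trans (le_max_right _ _) (le_trans (le_max_right _ _)
      (le_trans (le_max_right _ _) hD))))
  obtain ⟨-, hb4, hb2, -, -⟩ := betaJ_size c' hℓ2 hc hj
  obtain ⟨hb6, hn6⟩ := beta6_size c' hℓ2 hc hj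
  have hmz := hCz D χ hD₁ hq hp j hj
  obtain ⟨-, -, h7⟩ := hcirc D hD₂ j hj l₁ hl₁
  obtain ⟨κ, hκ, hbκ⟩ := Typed.AppendixB.betaJ_eq_of_mem c' D hj
  rw [h7]
  -- notation
  set ℓ : ℝ := ell D with hℓ
  set a : ℝ := alpha D with ha
  set b : ℂ := betaJ c' D j with hb
  set β : ℂ := beta6 D with hβ
  set L : ℝ := Real.log (P1 D) with hL
  have hℓ1 : 1 ≤ ℓ := by linarith only [hℓ2]
  have hℓ0 : 0 < ℓ := by linarith only [hℓ2]
  have h9 : a * ℓ ^ 9 = π := by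
    rw [ha, alpha, bigP, Real.log_exp, ← hℓ, div_mul_cancel₀ _ (pow_ne_zero _ hℓ0.ne')]
  have hKa : 80 * K * a ≤ 1 := by linarith only [hKα]
  have hLeq : L = 0.504 * ℓ ^ 9 := by rw [hL, log_P1_mu1]
  have hLlow : ℓ ^ 9 / 4 ≤ L := by rw [hLeq]; nlinarith [pow_pos hℓ0 9]
  have hL0 : 0 < L := lt_of_lt_of_le (by positivity) hLlow
  have hLc0' : (L : ℂ) ≠ 0 := by exact_mod_cast hL0.ne'
  have haL : a * L = 0.504 * π := by rw [hLeq, ← h9]; ring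
  have h11pos : 0 < ℓ ^ (1.1 : ℝ) := Real.rpow_pos_of_pos hℓ0 _
  have h1l : ℓ ≤ ℓ ^ (1.1 : ℝ) := by
    calc ℓ = ℓ ^ (1 : ℝ) := (Real.rpow_one ℓ).symm
      _ ≤ ℓ ^ (1.1 : ℝ) := Real.rpow_le_rpow_of_exponent_le hℓ1 (by norm_num)
  have h11le : ℓ ^ (1.1 : ℝ) ≤ L := by
    have h11 : ℓ ^ (1.1 : ℝ) ≤ ℓ ^ 2 := by
      calc ℓ ^ (1.1 : ℝ) ≤ ℓ ^ (2 : ℝ) := Real.rpow_le_rpow_of_exponent_le hℓ1 (by norm_num)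
        _ = ℓ ^ 2 := by norm_cast
    have hℓ7 : (4 : ℝ) ≤ ℓ ^ 7 := le_trans (by norm_num) (pow_le_pow_left₀ (by norm_num) hℓ2 7)
    have h44 : 4 * ℓ ^ 2 ≤ ℓ ^ 9 := by
      have h := mul_le_mul_of_nonneg_left hℓ7 (pow_pos hℓ0 2).le
      have e : ℓ ^ 2 * ℓ ^ 7 = ℓ ^ 9 := by ring
      linarith only [h, e]
    linarith only [h11, h44, hLlow]
  -- `α₁ = aℓ^{1.1}`, and `a ≤ α₁`
  have hα1 : alpha1 D = a * ℓ ^ (1.1 : ℝ) := by rw [alpha1, log_bigT]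
  have haα1 : a ≤ a * ℓ ^ (1.1 : ℝ) := by
    have : a * 1 ≤ a * ℓ ^ (1.1 : ℝ) := mul_le_mul_of_nonneg_left (le_trans hℓ1 h1l) hα0.le
    simpa using this
  have hα1_0 : 0 ≤ a * ℓ ^ (1.1 : ℝ) := by positivity
  -- `l₁`: `0 ≤ log l₁ ≤ ℓ^{1.1}`
  have hl₁0 : (0 : ℝ) < l₁ := by exact_mod_cast hl₁
  have hlog0 : 0 ≤ Real.log l₁ := Real.log_nonneg (by exact_mod_cast hl₁)
  have hlogT : Real.log l₁ ≤ ℓ ^ (1.1 : ℝ) := by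
    have h := Real.log_le_log hl₁0 hT.le
    rwa [bigT, Real.log_exp] at h
  -- `x = P₁/l₁ > 0`, `log x = L − log l₁`
  have hP1 : 0 < P1 D := by rw [P1]; exact Real.rpow_pos_of_pos (Real.exp_pos _) _
  have hx : 0 < P1 D / l₁ := div_pos hP1 hl₁0
  have hlogx : Real.log (P1 D / l₁) = L - Real.log l₁ := by
    rw [Real.log_div hP1.ne' hl₁0.ne', hL]
  set x : ℂ := ((P1 D / l₁ : ℝ) : ℂ) with hxdef
  have hx0 : x ≠ 0 := by rw [hxdef]; exact_mod_cast hx.ne'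
  -- `β`, `b`
  have hβ0 : β ≠ 0 := by intro h; rw [h, norm_zero] at hn6; linarith only [hn6, hα0]
  have hβb : β ≠ b := by intro h; rw [h, sub_self, norm_zero] at hb6; linarith only [hb6, hα0]
  have hβ6 : β = (((3 * a / 2 : ℝ)) : ℂ) * I := by rw [hβ, beta6, ← ha]; push_cast; ring
  have hnβb : ‖β - b‖ ≤ 13 / 2 * a := by
    calc ‖β - b‖ ≤ ‖β‖ + ‖b‖ := norm_sub_le _ _
      _ ≤ 3 / 2 * a + 4 * a := by rw [hn6]; linarith only [hb4]
      _ ≤ 13 / 2 * a := by linarith only [hα0]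
  -- `ζ₁` near `1`: the values at `1 + β` and `1 + β − b`
  have hβδ : ‖β‖ ≤ δ := by rw [hn6]; linarith only [hδα, hα0]
  have hβbδ : ‖β - b‖ ≤ δ := by linarith only [hnβb, hδα, hα0]
  obtain ⟨hf1, hf', -⟩ := hζ β hβδ
  obtain ⟨hg1, hg', hg0⟩ := hζ (β - b) hβbδ
  have e1 : (1 : ℂ) + (β - b) = 1 + β - b := by ring
  rw [e1] at hg1 hg' hg0
  set fβ : ℂ := riemannZeta₁ (1 + β) with hfβ
  set gβ : ℂ := riemannZeta₁ (1 + β - b) with hgβ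
  set f' : ℂ := deriv riemannZeta₁ (1 + β) with hf'def
  set g' : ℂ := deriv riemannZeta₁ (1 + β - b) with hg'def
  have hf1' : ‖fβ - 1‖ ≤ 1 / 32 := by
    calc ‖fβ - 1‖ ≤ K * ‖β‖ := hf1
      _ = K * (3 / 2 * a) := by rw [hn6]
      _ ≤ 1 / 32 := by linarith only [hKa, hK, hα0]
  have hg1' : ‖gβ - 1‖ ≤ 13 / 160 := by
    calc ‖gβ - 1‖ ≤ K * ‖β - b‖ := hg1
      _ ≤ K * (13 / 2 * a) := mul_le_mul_of_nonneg_left hnβb hK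
      _ ≤ 13 / 160 := by linarith only [hKa]
  have hfn : ‖fβ‖ ≤ 33 / 32 := by
    calc ‖fβ‖ = ‖(fβ - 1) + 1‖ := by ring_nf
      _ ≤ ‖fβ - 1‖ + ‖(1 : ℂ)‖ := norm_add_le _ _
      _ ≤ 33 / 32 := by rw [norm_one]; linarith only [hf1']
  have hgn : ‖gβ‖ ≤ 11 / 10 := by
    calc ‖gβ‖ = ‖(gβ - 1) + 1‖ := by ring_nf
      _ ≤ ‖gβ - 1‖ + ‖(1 : ℂ)‖ := norm_add_le _ _
      _ ≤ 11 / 10 := by rw [norm_one]; linarith only [hg1']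
  have hgl : 9 / 10 ≤ ‖gβ‖ := by
    have := norm_sub_norm_le (1 : ℂ) gβ
    rw [norm_one, norm_sub_rev] at this
    linarith only [this, hg1']
  have hgβ0 : gβ ≠ 0 := hg0
  have hgpos : 0 < ‖gβ‖ := by linarith only [hgl]
  -- `u = fβ/gβ`, `u' = (f'gβ − fβg')/gβ²`
  set u : ℂ := fβ / gβ with hudef
  set u' : ℂ := (f' * gβ - fβ * g') / gβ ^ 2 with hu'def
  have hun : ‖u‖ ≤ 7 := by
    rw [hudef, norm_div, div_le_iff₀ hgpos]; linarith only [hfn, hgl]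
  have hu1 : ‖u - 1‖ ≤ 10 * K * a := by
    have : u - 1 = (fβ - gβ) / gβ := by rw [hudef]; field_simp
    rw [this, norm_div, div_le_iff₀ hgpos]
    have hfg : ‖fβ - gβ‖ ≤ 9 * K * a := by
      calc ‖fβ - gβ‖ = ‖(fβ - 1) - (gβ - 1)‖ := by ring_nf
        _ ≤ ‖fβ - 1‖ + ‖gβ - 1‖ := norm_sub_le _ _
        _ ≤ K * ‖β‖ + K * ‖β - b‖ := add_le_add hf1 hg1
        _ ≤ K * (3 / 2 * a) + K * (13 / 2 * a) := by
            rw [hn6]; exact add_le_add le_rfl (mul_le_mul_of_nonneg_left hnβb hK)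
        _ ≤ 9 * K * a := by nlinarith only [hK, hα0]
    have hprod := mul_le_mul_of_nonneg_left hgl (by positivity : (0:ℝ) ≤ 10 * K * a)
    linarith only [hfg, hprod]
  have hu'n : ‖u'‖ ≤ 3 * K := by
    rw [hu'def, norm_div, norm_pow, div_le_iff₀ (by positivity)]
    have hnum : ‖f' * gβ - fβ * g'‖ ≤ 11 / 10 * K + 33 / 32 * K := by
      calc ‖f' * gβ - fβ * g'‖ ≤ ‖f' * gβ‖ + ‖fβ * g'‖ := norm_sub_le _ _
        _ = ‖f'‖ * ‖gβ‖ + ‖fβ‖ * ‖g'‖ := by rw [norm_mul, norm_mul]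
        _ ≤ K * (11 / 10) + 33 / 32 * K := by gcongr
        _ = 11 / 10 * K + 33 / 32 * K := by ring
    have hsq : (81 / 100 : ℝ) ≤ ‖gβ‖ ^ 2 := by
      have h := mul_le_mul hgl hgl (by norm_num) (le_trans (by norm_num) hgl)
      rw [pow_two]; linarith only [h]
    have hprod := mul_le_mul_of_nonneg_left hsq (by positivity : (0:ℝ) ≤ 3 * K)
    linarith only [hnum, hprod, hK]
  -- the local structure of `Z` at `β`
  have hzU : ∀ s : ℂ, ‖s‖ < 6 * a → riemannZeta₁ (1 + s - b) ≠ 0 := by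
    intro s hs
    have : ‖s - b‖ ≤ δ := by
      calc ‖s - b‖ ≤ ‖s‖ + ‖b‖ := norm_sub_le _ _
        _ ≤ 6 * a + 4 * a := by linarith only [hs, hb4]
        _ ≤ δ := by linarith only [hδα]
    have := (hζ (s - b) this).2.2
    rwa [show (1 : ℂ) + (s - b) = 1 + s - b by ring] at this
  have hβnorm : ‖β‖ < 6 * a := by rw [hn6]; linarith only [hα0]
  obtain ⟨hZβ, hZderiv⟩ := zetaRatio_local_at c' D j hβ0 hβb hβnorm hzU
  -- the Cauchy-formula identification: `G = H := s·Z(s)·xˢ/Lc` near `β`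
  set G : ℂ → ℂ := fun s =>
    riemannZeta₁ (1 + s) * (s - b) * (riemannZeta₁ (1 + s - b))⁻¹ * x ^ s / (L : ℂ) with hG
  set H : ℂ → ℂ := fun s => s * zetaRatio c' D j s * x ^ s / (L : ℂ) with hH
  have hopen : IsOpen {s : ℂ | s ≠ 0 ∧ s ≠ b ∧ ‖s‖ < 6 * a} := by
    refine (isOpen_ne.inter (isOpen_ne.inter ?_))
    exact isOpen_lt continuous_norm continuous_const
  have hmem : β ∈ {s : ℂ | s ≠ 0 ∧ s ≠ b ∧ ‖s‖ < 6 * a} := ⟨hβ0, hβb, hβnorm⟩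
  have hGH : G =ᶠ[𝓝 β] H := by
    refine Filter.eventuallyEq_of_mem (hopen.mem_nhds hmem) fun s hs => ?_
    simp only [hG, hH]
    have h1 : (1 : ℂ) + s ≠ 1 := fun h => hs.1 (by linear_combination h)
    have h2 : (1 : ℂ) + s - b ≠ 1 := fun h => hs.2.1 (by linear_combination h)
    rw [show zetaRatio c' D j s = riemannZeta (1 + s) / riemannZeta (1 + s - b) by rw [zetaRatio],
      riemannZeta_eq_inv_sub_mul h1, riemannZeta_eq_inv_sub_mul h2]
    have e1' : (1 : ℂ) + s - 1 = s := by ring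
    have e2' : (1 : ℂ) + s - b - 1 = s - b := by ring
    rw [e1', e2']
    have hsb' : s - b ≠ 0 := sub_ne_zero.mpr hs.2.1
    have hs0 : s ≠ 0 := hs.1
    have hzs : riemannZeta₁ (1 + s - b) ≠ 0 := hzU s hs.2.2
    field_simp
  have hGβ : G β = β * zetaRatio c' D j β * x ^ β / (L : ℂ) := hGH.self_of_nhds
  -- differentiability of `zetaRatio` at `β`
  have h1ne : (1 : ℂ) + β ≠ 1 := fun h => hβ0 (by linear_combination h)
  have h2ne : (1 : ℂ) + β - b ≠ 1 := fun h => hβb (by linear_combination h)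
  have hden : riemannZeta (1 + β - b) ≠ 0 := by
    rw [riemannZeta_eq_inv_sub_mul h2ne, show (1 : ℂ) + β - b - 1 = β - b by ring]
    exact mul_ne_zero (inv_ne_zero (sub_ne_zero.mpr hβb)) (hzU β hβnorm)
  have hzr_eq : zetaRatio c' D j = fun s => riemannZeta (1 + s) / riemannZeta (1 + s - b) := rfl
  have hzrd : DifferentiableAt ℂ (zetaRatio c' D j) β := by
    rw [hzr_eq]
    refine DifferentiableAt.div ?_ ?_ hden
    · exact (differentiableAt_riemannZeta h1ne).comp β (differentiableAt_id.const_add _)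
    · exact (differentiableAt_riemannZeta h2ne).comp β
        ((differentiableAt_id.const_add _).sub_const _)
  have hzr : HasDerivAt (zetaRatio c' D j) (deriv (zetaRatio c' D j) β) β := hzrd.hasDerivAt
  have hW : HasDerivAt (fun s : ℂ => x ^ s) (x ^ β * Complex.log x) β := by
    simpa using (hasDerivAt_id β).const_cpow (Or.inl hx0)
  have hHd : HasDerivAt H
      (((1 * zetaRatio c' D j β + β * deriv (zetaRatio c' D j) β) * x ^ β +
        β * zetaRatio c' D j β * (x ^ β * Complex.log x)) / (L : ℂ)) β := by
    have := (((hasDerivAt_id β).mul hzr).mul hW).div_const (L : ℂ)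
    simpa [hH] using this
  have hderivG : deriv G β = ((1 * zetaRatio c' D j β + β * deriv (zetaRatio c' D j) β) * x ^ β +
        β * zetaRatio c' D j β * (x ^ β * Complex.log x)) / (L : ℂ) := by
    rw [hGH.deriv_eq]; exact hHd.deriv
  have hlogxC : Complex.log x = ((Real.log (P1 D / l₁) : ℝ) : ℂ) := by
    rw [hxdef, Complex.ofReal_log hx.le]
  -- the circle value as `E (u(1−q)r + u′w + um)` with the quantities below
  have hres : -(G β / β ^ 2) + deriv G β / β = x ^ β *
      (u * (1 - b / β) * ((Real.log (P1 D / l₁) : ℂ) / (L : ℂ)) +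
        u' * ((β - b) / (β * (L : ℂ))) + u * (b / (β ^ 2 * (L : ℂ)))) := by
    rw [hderivG, hGβ, hlogxC,
      circle_residue_algebra₆ _ _ _ _ _ _ hβ0 hLc0',
      ← resBeta_algebra₆ _ _ u u' β b (L : ℂ) hβ0 hLc0', hZderiv, hZβ]
  have hmain : (1 - 2 * (j : ℂ) / 3 + (j : ℂ) / (1.134 * π * I)) * cexp (0.756 * π * I) =
      cexp (0.756 * π * I) * ((1 - 2 * (j : ℂ) / 3) + (j : ℂ) / (1.134 * π * I)) := by ring
  -- sizes
  have hEexp : x ^ β = cexp (((3 * a / 2 * (L - Real.log l₁) : ℝ) : ℂ) * I) := by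
    rw [hxdef, hβ6, ofReal_cpow_mul_I₆ hx, hlogx]
  have hEn : ‖x ^ β‖ ≤ 1 := by rw [hEexp, Complex.norm_exp_ofReal_mul_I]
  have he₀' : cexp (0.756 * π * I) = cexp (((0.756 * π : ℝ)) * I) := by congr 1; push_cast; ring
  have hen : ‖cexp (0.756 * π * I)‖ ≤ 1 := by rw [he₀', Complex.norm_exp_ofReal_mul_I]
  have hqn : ‖b / β‖ ≤ 3 := by
    rw [norm_div, div_le_iff₀ (by rw [hn6]; positivity), hn6]; linarith only [hb4, hα0]
  have hnL : ‖(L : ℂ)‖ = L := by rw [Complex.norm_real, Real.norm_eq_abs, abs_of_pos hL0]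
  have hnr : ‖((Real.log (P1 D / l₁) : ℝ) : ℂ)‖ = L - Real.log l₁ := by
    rw [Complex.norm_real, Real.norm_eq_abs, hlogx, abs_of_nonneg (by linarith only [hlogT, h11le])]
  have hrn : ‖(Real.log (P1 D / l₁) : ℂ) / (L : ℂ)‖ ≤ 1 := by
    rw [norm_div, hnr, hnL, div_le_one hL0]
    linarith only [hlog0]
  have hmn : ‖b / (β ^ 2 * (L : ℂ))‖ ≤ 2 := by
    rw [norm_div, norm_mul, norm_pow, hnL, hn6, div_le_iff₀ (by positivity)]
    have hL3 : (3 / 2 * a) ^ 2 * L = 1.134 * (π * a) := by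
      have : (3 / 2 * a) ^ 2 * L = 9 / 4 * a * (a * L) := by ring
      rw [this, haL]; ring
    have hπa : 3 * a ≤ π * a := mul_le_mul_of_nonneg_right Real.pi_gt_three.le hα0.le
    calc ‖b‖ ≤ 4 * a := hb4
      _ ≤ 2 * (1.134 * (π * a)) := by linarith only [hπa, hα0]
      _ = 2 * ((3 / 2 * a) ^ 2 * L) := by rw [hL3]
  -- the six approximations, each `≤ ε = C₁·α₁`
  set ε : ℝ := C₁ * (a * ℓ ^ (1.1 : ℝ)) with hεdef
  have hε0 : 0 ≤ ε := by positivity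
  have h1 : ‖x ^ β - cexp (0.756 * π * I)‖ ≤ ε := by
    rw [hEexp, he₀']
    refine (norm_cexp_I_sub_cexp_I_le₆ _ _).trans ?_
    have hid : 3 * a / 2 * (L - Real.log l₁) - 0.756 * π = -(3 / 2 * (a * Real.log l₁)) := by
      rw [hLeq]; linear_combination (0.756 : ℝ) * h9
    rw [hid, abs_neg, abs_of_nonneg (by positivity)]
    have hll : a * Real.log l₁ ≤ a * ℓ ^ (1.1 : ℝ) := mul_le_mul_of_nonneg_left hlogT hα0.le
    have h28 : 28 * (a * ℓ ^ (1.1 : ℝ)) ≤ C₁ * (a * ℓ ^ (1.1 : ℝ)) :=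
      mul_le_mul_of_nonneg_right hC₁28 hα1_0
    rw [hεdef]
    linarith only [hll, h28, hlog0, hα0, hα1_0]
  have h2 : ‖u - 1‖ ≤ ε := by
    calc ‖u - 1‖ ≤ 10 * K * a := hu1
      _ ≤ 10 * K * (a * ℓ ^ (1.1 : ℝ)) := by gcongr
      _ ≤ ε := by rw [hεdef]; gcongr
  have h3 : ‖(Real.log (P1 D / l₁) : ℂ) / (L : ℂ) - 1‖ ≤ ε := by
    have hr1 : (Real.log (P1 D / l₁) : ℂ) / (L : ℂ) - 1 = ((-(Real.log l₁ / L) : ℝ) : ℂ) := by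
      rw [hlogx]; push_cast; field_simp; ring
    rw [hr1, Complex.norm_real, Real.norm_eq_abs, abs_neg, abs_of_nonneg (div_nonneg hlog0 hL0.le),
      div_le_iff₀ hL0]
    have hkey : ℓ ^ (1.1 : ℝ) ≤ 2 * (a * ℓ ^ (1.1 : ℝ)) * L := by
      have hL1 : a * (ℓ ^ 9 / 4) ≤ a * L := mul_le_mul_of_nonneg_left hLlow hα0.le
      have h2aL : 1 ≤ 2 * a * L := by
        have hπ := Real.pi_gt_three
        have : a * (ℓ ^ 9 / 4) = π / 4 := by rw [← h9]; ring
        linarith only [hπ, this, hL1]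
      have := mul_le_mul_of_nonneg_left h2aL h11pos.le
      linarith only [this]
    have h2C : 2 * (a * ℓ ^ (1.1 : ℝ)) * L ≤ ε * L := by
      rw [hεdef]
      have : (2 : ℝ) ≤ C₁ := by linarith only [hC₁28]
      gcongr
    linarith only [hlogT, hkey, h2C]
  have h4 : ‖b / β - 2 * (j : ℂ) / 3‖ ≤ ε := by
    have hq' : b / β - 2 * (j : ℂ) / 3 = (((2 * j / 3) * (κ * c' * a * ℓ) : ℝ) : ℂ) := by
      rw [hbκ, hβ6]
      have ha' : (a : ℂ) ≠ 0 := by exact_mod_cast hα0.ne'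
      push_cast
      field_simp
      ring
    rw [hq', Complex.norm_real, Real.norm_eq_abs]
    have hj3 : (j : ℝ) ≤ 3 := by
      simp only [Finset.mem_insert, Finset.mem_singleton] at hj
      rcases hj with rfl | rfl | rfl <;> norm_num
    have hj0 : (0 : ℝ) ≤ j := Nat.cast_nonneg _
    calc |2 * (j : ℝ) / 3 * (κ * c' * a * ℓ)| = 2 * j / 3 * (|κ| * |c'| * a * ℓ) := by
          rw [abs_mul, abs_of_nonneg (by positivity : (0:ℝ) ≤ 2 * j / 3), abs_mul, abs_mul,
            abs_mul, abs_of_pos hα0, abs_of_pos hℓ0]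
      _ ≤ 2 * 3 / 3 * (5 * |c'| * a * ℓ) := by gcongr
      _ = 10 * |c'| * (a * ℓ) := by ring
      _ ≤ 10 * |c'| * (a * ℓ ^ (1.1 : ℝ)) := by gcongr
      _ ≤ ε := by rw [hεdef]; gcongr
  have h5 : ‖b / (β ^ 2 * (L : ℂ)) - (j : ℂ) / (1.134 * π * I)‖ ≤ ε := by
    have : b / (β ^ 2 * (L : ℂ)) - (j : ℂ) / (1.134 * π * I) =
        -((-betaJ c' D j / (beta6 D ^ 2 * (Real.log (P1 D) : ℂ))) - (-((j : ℂ) / (1.134 * π * I)))) := by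
      rw [← hb, ← hβ, ← hL]; ring
    rw [this, norm_neg]
    refine hmz.trans ?_
    rw [hα1, hεdef]
    exact mul_le_mul_of_nonneg_right hC₁z hα1_0
  have h6 : ‖(β - b) / (β * (L : ℂ))‖ ≤ ε := by
    rw [norm_div, norm_mul, Complex.norm_real, Real.norm_eq_abs, abs_of_pos hL0, hn6,
      div_le_iff₀ (by positivity)]
    have hL' : 28 * a * (ℓ ^ 9 / 4) ≤ ε * L := by
      calc 28 * a * (ℓ ^ 9 / 4) ≤ 28 * a * L := by gcongr
        _ ≤ C₁ * a * L := by gcongr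
        _ ≤ C₁ * (a * ℓ ^ (1.1 : ℝ)) * L := by
            have h' := mul_le_mul_of_nonneg_left haα1 hC₁0
            have h'' := mul_le_mul_of_nonneg_right h' hL0.le
            linarith only [h'']
        _ = ε * L := by rw [hεdef]
    have hprod := mul_le_mul_of_nonneg_left hL' hα0.le
    have h7 : a * (28 * a * (ℓ ^ 9 / 4)) = 7 * π * a := by rw [← h9]; ring
    have hπa : 3 * a ≤ π * a := mul_le_mul_of_nonneg_right Real.pi_gt_three.le hα0.le
    calc ‖β - b‖ ≤ 13 / 2 * a := hnβb
      _ ≤ 3 / 2 * (7 * π * a) := by linarith only [hπa, hα0]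
      _ = 3 / 2 * (a * (28 * a * (ℓ ^ 9 / 4))) := by rw [h7]
      _ ≤ 3 / 2 * (a * (ε * L)) := by linarith only [hprod]
      _ = ε * (3 / 2 * a * L) := by ring
  -- assemble
  have hbook := main_term_bookkeeping₆ (x ^ β) (cexp (0.756 * π * I)) u u'
    ((Real.log (P1 D / l₁) : ℂ) / (L : ℂ)) (b / β) (2 * (j : ℂ) / 3) (b / (β ^ 2 * (L : ℂ)))
    ((j : ℂ) / (1.134 * π * I)) ((β - b) / (β * (L : ℂ))) hε0 (by positivity : (0:ℝ) ≤ 3 * K)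
    hEn hen hun hqn hrn hmn hu'n h1 h2 h3 h4 h5 h6
  rw [hres, hmain, hα1]
  refine hbook.trans (le_of_eq ?_)
  rw [hεdef]
  ring

end Mu1Value

end Literature.NumberTheory.LFunctions.Zhang2022.Skeleton
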